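import Mathlib
import Summits.Ventures.FusionMHD.Models.CerfonFreidbergIterLikeQHalfMercDefs
import HarnessLib

/-!
# Ventures/FusionMHD — Models/CerfonFreidbergIterLikeQHalfMercPanels19.lean: KERNEL CHECK of the Mercier-register certificates of panel(s) 31 (of 32)
# at `ψ_N = 1/2` of THE Cerfon–Freidberg ITER-like instance

HONEST FRAMING (LADDER-GRIDFUSION three columns; CF rung; «F2.R2-CF-MERCIER-IMPLICIT» step (2), F2-SCOPING v1.6 §10(c)).  One `decide +kernel` (≈ 70 s): for each
listed panel the obligation `CFIterLike.QHalfMerc.MercCert.ok` (`Models/CerfonFreidbergIterLikeQHalfMercDefs.lean`) — the Taylor-model run of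
`progM = progA ++ block1 ++ block2 ++ block3M` over ★ #117's parameter box is ACCEPTED (both `inv` certificates included) and the kernel's FOUR panel-integral
enclosures (`g_W`, `g_Aσ`, `g_AR`, `g_B1` along the approximant) lie inside the claimed integers (read off a compiled `#eval` of the same functions, slack one unit of
`2⁻⁶⁰`; float truth inside every panel, `HOME/models/model-7/g7/genqm/truthM.json`).  MODELLED: analytic Cerfon–Freidberg family; nothing about a device or
stability.  No `native_decide`.  Typer/prover: gridfusion-model-7 (g7), 2026-08-27.
Citations: Jardin 2010 §8.5 (8.134) [Jardin2010]; Mahboubi–Melquiond–Sibut-Pinote 2016 §3.2 Lemma 3 [MahboubiMelquiondSibutpinote2016].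
-/

namespace Summit.Ventures.FusionMHD.Models.CFIterLike.QHalfMerc

/-- Mercier-register certificate data of panel(s) 31. [instance data] -/
def mercCert19 : List MercCert := [
  { j := 31, cand1 := [751733570500371546112, -293152696643552608256, 9439644766439675527168, -3766488534561026211840, 60739063778312800174080, -18207879650546552930304, 191927363517266903695360, 58699499666296333664256, -139505931704969069592576, 19646256011213652287815680, -1224372521979652143168094208, -27230143296477336291462086656, 1215056757604186513427784531968],
    cand2 := [602656637529941999616, -140689816309451325440, 4529472563981535150080, -1758031699621984862208, 28491602704537713901568, -13995241354800316547072, 152085568014686177198080, -76408674537163498455040, 503389123335376435412992, -382512985356725043331072, 509932722913651463399931904, -1218695344382706804699693056, -792715480485767567435406245888],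
    deg := 12, e1 := 45, e2 := 44, wlo := 462431998384669258, whi := 462432136994824247, slo := 9273237726667737252, shi := 9273238350487002917,
    rlo := 5976085235293065717, rhi := 5976085657315475360, blo := 14389510689742302720, bhi := 14389511609616016035 }]

/-- **KERNEL CHECK** of the four Mercier registers on panel(s) 31. -/
theorem mercCert19_ok : CFIterLike.QHalfMerc.mercCert19.all MercCert.ok = true := by
  decide +kernel

end Summit.Ventures.FusionMHD.Models.CFIterLike.QHalfMerc
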